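import Summits.SmoothPoincare4.SmoothPoincare4.Theorems.CongruenceShadowsAgkCor6SufficiencySpineDefs
import Summits.SmoothPoincare4.SmoothPoincare4.Theorems.CongruenceShadowsAgkCor6SufficiencyStubSeamFormModel
import Literature.Topology.FourManifolds.RegularSublevelSet

/-!
# Helpers for stub `stub_seamForm` of line `lp-by-sphere-system-surgery` (crux `AgkCor6Sufficiency`,
item stmt-SmoothPoincare4-10894, routes CongruenceShadows / GroupTrisection; lead reshape r5, A3):
the local analysis at a seam point off the central surface

Let `S₀, S₁, S₂` cover `X` with pairwise "interior-disjoint" compact pieces, and let the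
reference sector `Sr = S (refIdx m)` and the normalised sector `Sn = S (normIdx m)` of seam `m`
carry ambient Morse presentations `Gr`, `Gn` (`= 1` exactly at the non-interior points, `< 1`
inside, regular at the non-interior points off `F = ⋂ S l`), `Sr` having half-slice charts off
`F`.  At a seam point `y ∈ Sr ∩ Sn ∖ F` we read everything in a half-slice chart of `Sr`
avoiding the third piece `S m` (`Sr = {z₀ ≥ 0}`, `Sn = {z₀ ≤ 0}`, seam `= {z₀ = 0}` there) and
apply the local model `localModel` (`…StubSeamFormModel.lean`).  Result (`seamLocal`, bundled in
the registered helper stub `stub_seamFormLocalToolkit : SeamFormLocalToolkit`): open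
`V ∋ y`, `V'` with `closure V ⊆ V'` and `η > 0` such that on `V'` the functions `Gr`, `Gn` are regular,
`{Gr = 1} = Sr ∩ Sn`, `Sr = {Gr ≤ 1}`, `Sn = {Gr ≥ 1}`, and every smooth function agreeing
near a point of `V'` with `Gn + ψ(Gr - 1)(2 - Gr - Gn)` for a plateau `ψ` with `|tψ'(t)| ≤ η`
is regular there.

## References

* A. Abrams, D. Gay, R. Kirby, *Group trisections and smooth 4-manifolds*, Geom. Topol. 22
  (2018), proof of Thm. 5. [AbramsGayKirby2018]
* J. Milnor, *Lectures on the h-cobordism theorem* (1965), §3. [Milnor1965]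
-/

noncomputable section

-- the prescribed namespace `Summit.<P>.<Sub>.…` duplicates `SmoothPoincare4` (P = Sub)
set_option linter.dupNamespace false

open Set Function Filter Metric
open scoped Manifold ContDiff Topology

namespace Summit.SmoothPoincare4.SmoothPoincare4.Cruxes.AgkCor6Sufficiency.LpBySphereSystemSurgery

open Literature.Topology.FourManifolds

/-- The two sectors of a seam and the third one exhaust the three pieces: a point of all of
`S (refIdx m)`, `S (normIdx m)`, `S m` lies in `⋂ S l`. -/
theorem mem_iInter_of_mem_three {X : Type} {S : Fin 3 → Set X} (m : Fin 3) {x : X}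
    (hr : x ∈ S (refIdx m)) (hn : x ∈ S (normIdx m)) (hm : x ∈ S m) : x ∈ ⋂ l, S l := by
  refine mem_iInter.2 fun l => ?_
  fin_cases m <;> fin_cases l <;> simp_all [refIdx, normIdx]

variable {X : Type} [TopologicalSpace X] [ChartedSpace (EuclideanSpace ℝ (Fin 4)) X]

/-- **The local analysis at a seam point off the central surface** (see the module docstring).
[cite: AbramsGayKirby2018, proof of Thm. 5] -/
theorem seamLocal [T2Space X] [IsManifold (𝓡 4) ∞ X] {S : Fin 3 → Set X}
    (hcov : (⋃ l, S l) = univ) (hcomp : ∀ l, IsCompact (S l))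
    (hdisj : ∀ l l', l ≠ l' → Disjoint (interior (S l)) (S l')) (m : Fin 3) {Gr Gn : X → ℝ}
    (hGr : ContMDiff (𝓡 4) 𝓘(ℝ, ℝ) ∞ Gr) (hGn : ContMDiff (𝓡 4) 𝓘(ℝ, ℝ) ∞ Gn)
    (hr1 : ∀ p ∈ S (refIdx m), p ∉ interior (S (refIdx m)) → Gr p = 1)
    (hr2 : ∀ p ∈ interior (S (refIdx m)), Gr p < 1)
    (hr3 : ∀ p ∈ S (refIdx m), p ∉ interior (S (refIdx m)) → p ∉ (⋂ l, S l) →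
      ¬ IsMCriticalPt (𝓡 4) Gr p)
    (hn1 : ∀ p ∈ S (normIdx m), p ∉ interior (S (normIdx m)) → Gn p = 1)
    (hn2 : ∀ p ∈ interior (S (normIdx m)), Gn p < 1)
    (hn3 : ∀ p ∈ S (normIdx m), p ∉ interior (S (normIdx m)) → p ∉ (⋂ l, S l) →
      ¬ IsMCriticalPt (𝓡 4) Gn p)
    (hhalf : ∀ p ∈ S (refIdx m), p ∉ (⋂ l, S l) →
      ∃ D : HalfSliceChart (𝓡 4) (S (refIdx m)), p ∈ D.Θ.source ∧ ∀ q ∈ D.Θ.source, q ∉ ⋂ l, S l)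
    {y : X} (hy : y ∈ S (refIdx m) ∩ S (normIdx m)) (hyF : y ∉ ⋂ l, S l) :
    ∃ (V V' : Set X), IsOpen V ∧ IsOpen V' ∧ y ∈ V ∧ closure V ⊆ V' ∧ ∃ η : ℝ, 0 < η ∧
      (∀ x ∈ V', ¬ IsMCriticalPt (𝓡 4) Gr x) ∧ (∀ x ∈ V', ¬ IsMCriticalPt (𝓡 4) Gn x) ∧
      (∀ x ∈ V', Gr x = 1 ↔ x ∈ S (refIdx m) ∩ S (normIdx m)) ∧
      (∀ x ∈ V', x ∈ S (refIdx m) ↔ Gr x ≤ 1) ∧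
      (∀ x ∈ V', x ∈ S (normIdx m) ↔ 1 ≤ Gr x) ∧
      (∀ ψ : ℝ → ℝ, Differentiable ℝ ψ → (∀ t, 0 ≤ ψ t ∧ ψ t ≤ 1) →
        (∀ t, |t * deriv ψ t| ≤ η) → ∀ x ∈ V', ∀ f : X → ℝ, ContMDiff (𝓡 4) 𝓘(ℝ, ℝ) ∞ f →
          (f =ᶠ[𝓝 x] fun w => Gn w + ψ (Gr w - 1) * (1 - (Gr w - 1) - Gn w)) →
          ¬ IsMCriticalPt (𝓡 4) f x) := by
  classical
  set Sr := S (refIdx m) with hSr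
  set Sn := S (normIdx m) with hSn
  have hrn : refIdx m ≠ normIdx m := refIdx_ne_normIdx m
  -- ### the chart: a half-slice chart of `Sr` at `y`, restricted to avoid `S m`
  obtain ⟨D₀, hyD₀, -⟩ := hhalf y hy.1 hyF
  have hySm : y ∉ S m := fun h => hyF (mem_iInter_of_mem_three m hy.1 hy.2 h)
  set D := D₀.restrOpen (S m)ᶜ (hcomp m).isClosed.isOpen_compl with hD
  have hsrc : D.Θ.source = D₀.Θ.source ∩ (S m)ᶜ := by
    rw [hD, HalfSliceChart.restrOpen_Θ, OpenPartialHomeomorph.restrOpen_source]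
  have hyD : y ∈ D.Θ.source := by rw [hsrc]; exact ⟨hyD₀, hySm⟩
  have hDSm : ∀ q ∈ D.Θ.source, q ∉ S m := fun q hq => by rw [hsrc] at hq; exact hq.2
  set Θ := D.Θ with hΘ
  have hΘs : ContMDiffOn (𝓡 4) 𝓘(ℝ, EuclideanSpace ℝ (Fin 4)) ∞ Θ Θ.source := D.contMDiffOn_toFun
  have hΘs' : ContMDiffOn 𝓘(ℝ, EuclideanSpace ℝ (Fin 4)) (𝓡 4) ∞ Θ.symm Θ.target :=
    D.contMDiffOn_symm
  -- ### membership in the chart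
  have hmemSr : ∀ q ∈ Θ.source, q ∈ Sr ↔ 0 ≤ Θ q 0 := D.mem_iff
  have hGr_le : ∀ q ∈ Sr, Gr q ≤ 1 := fun q hq => by
    by_cases hint : q ∈ interior Sr
    · exact (hr2 q hint).le
    · exact (hr1 q hq hint).le
  have hGn_le : ∀ q ∈ Sn, Gn q ≤ 1 := fun q hq => by
    by_cases hint : q ∈ interior Sn
    · exact (hn2 q hint).le
    · exact (hn1 q hq hint).le
  -- non-interior points of `Sr` in the source lie in `Sn`
  have hSn_of : ∀ q ∈ Θ.source, q ∉ interior Sr → q ∈ Sn := by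
    intro q hq hnint
    have h1 : q ∈ closure Srᶜ := by rw [closure_compl]; exact hnint
    have h2 : Srᶜ ⊆ Sn ∪ S m := by
      intro w hw
      have hw' : w ∈ ⋃ l, S l := by rw [hcov]; exact mem_univ w
      obtain ⟨l, hl⟩ := mem_iUnion.1 hw'
      have hcases : l = refIdx m ∨ l = normIdx m ∨ l = m := by
        fin_cases m <;> fin_cases l <;> simp [refIdx, normIdx]
      rcases hcases with rfl | rfl | rfl
      · exact absurd hl hw
      · exact Or.inl hl
      · exact Or.inr hl
    have h3 : closure Srᶜ ⊆ Sn ∪ S m :=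
      ((hcomp _).isClosed.union (hcomp m).isClosed).closure_subset_iff.2 h2
    rcases h3 h1 with h | h
    · exact h
    · exact absurd h (hDSm q hq)
  have hnint_of_le : ∀ q ∈ Θ.source, Θ q 0 ≤ 0 → q ∉ interior Sr := by
    intro q hq hle hint
    have hqS : q ∈ Sr := interior_subset hint
    have := (D.apply_zero_pos_iff_mem_interior hq hqS).2 hint
    linarith
  have hint_of_pos : ∀ q ∈ Θ.source, 0 < Θ q 0 → q ∈ interior Sr := fun q hq hpos =>
    (D.apply_zero_pos_iff_mem_interior hq ((hmemSr q hq).2 hpos.le)).1 hpos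
  have hSn_nint : ∀ q ∈ Sn, q ∉ interior Sr := fun q hq hint =>
    Set.disjoint_left.1 (hdisj _ _ hrn) hint hq
  have hSr_nint : ∀ q ∈ Sr, q ∉ interior Sn := fun q hq hint =>
    Set.disjoint_left.1 (hdisj _ _ hrn.symm) hint hq
  have hy0 : Θ y 0 = 0 := by
    have h1 : 0 ≤ Θ y 0 := (hmemSr y hyD).1 hy.1
    rcases h1.lt_or_eq with h | h
    · exact absurd (hint_of_pos y hyD h) (hSn_nint y hy.2)
    · exact h.symm
  -- ### the model functions
  set Tg := Θ.target with hTg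
  have hTgo : IsOpen Tg := Θ.open_target
  set zc := Θ y with hzc
  have hzcT : zc ∈ Tg := Θ.map_source hyD
  set σ : EuclideanSpace ℝ (Fin 4) → ℝ := fun z => Gr (Θ.symm z) - 1 with hσ
  set g : EuclideanSpace ℝ (Fin 4) → ℝ := fun z => Gn (Θ.symm z) with hg
  have hGrT : ContDiffOn ℝ ∞ (Gr ∘ Θ.symm) Tg :=
    contMDiffOn_iff_contDiffOn.1 (hGr.comp_contMDiffOn hΘs')
  have hGnT : ContDiffOn ℝ ∞ (Gn ∘ Θ.symm) Tg :=
    contMDiffOn_iff_contDiffOn.1 (hGn.comp_contMDiffOn hΘs')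
  have hσs : ContDiffOn ℝ 1 σ Tg := (hGrT.sub contDiffOn_const).of_le (by simp)
  have hgs : ContDiffOn ℝ 1 g Tg := hGnT.of_le (by simp)
  -- translation of points of the target
  have hpt : ∀ z ∈ Tg, Θ.symm z ∈ Θ.source ∧ Θ (Θ.symm z) = z := fun z hz =>
    ⟨Θ.map_target hz, Θ.right_inv hz⟩
  have hσle : ∀ z ∈ Tg, 0 ≤ z 0 → σ z ≤ 0 := by
    intro z hz h0
    obtain ⟨hs, heq⟩ := hpt z hz
    have hS : Θ.symm z ∈ Sr := (hmemSr _ hs).2 (by rw [heq]; exact h0)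
    show Gr (Θ.symm z) - 1 ≤ 0
    linarith [hGr_le _ hS]
  have hσ0 : ∀ z ∈ Tg, z 0 = 0 → σ z = 0 := by
    intro z hz h0
    obtain ⟨hs, heq⟩ := hpt z hz
    have hS : Θ.symm z ∈ Sr := (hmemSr _ hs).2 (by rw [heq, h0])
    have hni : Θ.symm z ∉ interior Sr := hnint_of_le _ hs (by rw [heq, h0])
    show Gr (Θ.symm z) - 1 = 0
    rw [hr1 _ hS hni]; ring
  have hgle : ∀ z ∈ Tg, z 0 ≤ 0 → g z ≤ 1 := by
    intro z hz h0
    obtain ⟨hs, heq⟩ := hpt z hz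
    exact hGn_le _ (hSn_of _ hs (hnint_of_le _ hs (by rw [heq]; exact h0)))
  have hg1 : ∀ z ∈ Tg, z 0 = 0 → g z = 1 := by
    intro z hz h0
    obtain ⟨hs, heq⟩ := hpt z hz
    have hS : Θ.symm z ∈ Sr := (hmemSr _ hs).2 (by rw [heq, h0])
    have hSn' : Θ.symm z ∈ Sn := hSn_of _ hs (hnint_of_le _ hs (by rw [heq, h0]))
    exact hn1 _ hSn' (hSr_nint _ hS)
  -- regularity at `y`, read in the chart
  have hcrit : ∀ (f : X → ℝ), ContMDiff (𝓡 4) 𝓘(ℝ, ℝ) ∞ f → ∀ q ∈ Θ.source,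
      (IsMCriticalPt (𝓡 4) f q ↔ fderiv ℝ (f ∘ Θ.symm) (Θ q) = 0) := fun f hf q hq =>
    isMCriticalPt_iff_fderiv_comp_symm_eq_zero hΘs hΘs' hq (hf.mdifferentiableAt (by simp))
  have hσ' : fderiv ℝ σ zc ≠ 0 := by
    have h1 : ¬ IsMCriticalPt (𝓡 4) Gr y := hr3 y hy.1 (hSn_nint y hy.2) hyF
    rw [hcrit Gr hGr y hyD] at h1
    have h2 : fderiv ℝ σ zc = fderiv ℝ (Gr ∘ Θ.symm) zc := by
      rw [hσ]; exact fderiv_sub_const 1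
    rwa [h2]
  have hg' : fderiv ℝ g zc ≠ 0 := by
    have h1 : ¬ IsMCriticalPt (𝓡 4) Gn y := hn3 y hy.2 (hSr_nint y hy.1) hyF
    rwa [hcrit Gn hGn y hyD] at h1
  -- ### the local model
  obtain ⟨r, hr, hbT, η, hη, hc1, hc2⟩ :=
    localModel hTgo hzcT hy0 hσs hgs hσle hσ0 hσ' hgle hg1 hg'
  -- ### the neighbourhoods
  set V' : Set X := Θ.source ∩ Θ ⁻¹' ball zc r with hV'
  set V : Set X := Θ.source ∩ Θ ⁻¹' ball zc (r / 2) with hV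
  have hV'o : IsOpen V' := Θ.isOpen_inter_preimage isOpen_ball
  have hVo : IsOpen V := Θ.isOpen_inter_preimage isOpen_ball
  have hyV : y ∈ V := ⟨hyD, mem_ball_self (half_pos hr)⟩
  have hclV : closure V ⊆ V' := by
    have hcb : closedBall zc (r / 2) ⊆ ball zc r := closedBall_subset_ball (by linarith)
    have hK : IsCompact (Θ.symm '' closedBall zc (r / 2)) :=
      (isCompact_closedBall zc (r / 2)).image_of_continuousOn
        (Θ.continuousOn_symm.mono (hcb.trans hbT))
    have hVK : V ⊆ Θ.symm '' closedBall zc (r / 2) := fun x hx =>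
      ⟨Θ x, ball_subset_closedBall hx.2, Θ.left_inv hx.1⟩
    refine (hK.isClosed.closure_subset_iff.2 hVK).trans ?_
    rintro x ⟨z, hz, rfl⟩
    have hzT : z ∈ Tg := hbT (hcb hz)
    refine ⟨Θ.map_target hzT, ?_⟩
    show Θ (Θ.symm z) ∈ ball zc r
    rw [Θ.right_inv hzT]; exact hcb hz
  -- points of `V'`
  have hV'pt : ∀ x ∈ V', x ∈ Θ.source ∧ Θ x ∈ ball zc r ∧ Θ.symm (Θ x) = x := fun x hx =>
    ⟨hx.1, hx.2, Θ.left_inv hx.1⟩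
  have hσx : ∀ x ∈ V', σ (Θ x) = Gr x - 1 := fun x hx => by
    show Gr (Θ.symm (Θ x)) - 1 = Gr x - 1
    rw [(hV'pt x hx).2.2]
  refine ⟨V, V', hVo, hV'o, hyV, hclV, η, hη, ?_, ?_, ?_, ?_, ?_, ?_⟩
  · -- `Gr` is regular on `V'`
    intro x hx
    obtain ⟨hxs, hxb, hxx⟩ := hV'pt x hx
    rw [hcrit Gr hGr x hxs]
    have h2 : fderiv ℝ σ (Θ x) = fderiv ℝ (Gr ∘ Θ.symm) (Θ x) := by
      rw [hσ]; exact fderiv_sub_const 1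
    rw [← h2]
    exact (hc1 _ hxb).2.2.2.1
  · -- `Gn` is regular on `V'`
    intro x hx
    obtain ⟨hxs, hxb, hxx⟩ := hV'pt x hx
    rw [hcrit Gn hGn x hxs]
    exact (hc1 _ hxb).2.2.2.2
  · -- `{Gr = 1} = Sr ∩ Sn`
    intro x hx
    obtain ⟨hxs, hxb, hxx⟩ := hV'pt x hx
    constructor
    · intro h1
      have h0 : Θ x 0 = 0 := ((hc1 _ hxb).1).1 (by rw [hσx x hx, h1]; ring)
      have hxSr : x ∈ Sr := (hmemSr x hxs).2 h0.ge
      exact ⟨hxSr, hSn_of x hxs (hnint_of_le x hxs h0.le)⟩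
    · rintro ⟨hxSr, hxSn⟩
      exact hr1 x hxSr (hSn_nint x hxSn)
  · -- `Sr = {Gr ≤ 1}`
    intro x hx
    obtain ⟨hxs, hxb, hxx⟩ := hV'pt x hx
    refine ⟨fun h => hGr_le x h, fun h => ?_⟩
    have hσle' : σ (Θ x) ≤ 0 := by rw [hσx x hx]; linarith
    have h0 : 0 ≤ Θ x 0 := by
      by_contra hneg
      have := (hc1 _ hxb).2.1 (not_le.1 hneg)
      linarith
    exact (hmemSr x hxs).2 h0
  · -- `Sn = {Gr ≥ 1}`
    intro x hx
    obtain ⟨hxs, hxb, hxx⟩ := hV'pt x hx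
    constructor
    · intro hxSn
      have hni : x ∉ interior Sr := hSn_nint x hxSn
      have h0 : Θ x 0 ≤ 0 := by
        by_contra hpos
        exact hni (hint_of_pos x hxs (not_le.1 hpos))
      have hσge : 0 ≤ σ (Θ x) := by
        rcases h0.lt_or_eq with h | h
        · exact ((hc1 _ hxb).2.1 h).le
        · exact (((hc1 _ hxb).1).2 h).ge
      rw [hσx x hx] at hσge
      linarith
    · intro h1
      have hσge : 0 ≤ σ (Θ x) := by rw [hσx x hx]; linarith
      have h0 : Θ x 0 ≤ 0 := by
        by_contra hpos
        have := (hc1 _ hxb).2.2.1 (not_le.1 hpos)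
        linarith
      exact hSn_of x hxs (hnint_of_le x hxs h0)
  · -- no critical points of the modified functions
    intro ψ hψd hψ01 hψη x hx f hf hfeq
    obtain ⟨hxs, hxb, hxx⟩ := hV'pt x hx
    rw [hcrit f hf x hxs]
    have hfT : ContDiffOn ℝ ∞ (f ∘ Θ.symm) Tg :=
      contMDiffOn_iff_contDiffOn.1 (hf.comp_contMDiffOn hΘs')
    have hzT : Θ x ∈ Tg := Θ.map_source hxs
    have hfd : DifferentiableAt ℝ (f ∘ Θ.symm) (Θ x) :=
      ((hfT _ hzT).contDiffAt (hTgo.mem_nhds hzT)).differentiableAt (by simp)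
    refine hc2 ψ hψd hψ01 hψη (Θ x) hxb (f ∘ Θ.symm) hfd ?_
    have hca : ContinuousAt Θ.symm (Θ x) := Θ.continuousAt_symm hzT
    have hlim : Tendsto Θ.symm (𝓝 (Θ x)) (𝓝 x) := by
      have := hca.tendsto; rwa [hxx] at this
    filter_upwards [hlim.eventually hfeq] with w hw
    simpa only [comp_apply] using hw

/-! ## The toolkit (a registered helper stub) -/

/-- **The local seam toolkit** (registered helper stub of the line, proved in this file): the
local analysis `seamLocal` at a seam point off the central surface. -/
def SeamFormLocalToolkit : Prop :=
  ∀ (X : Type) [TopologicalSpace X] [T2Space X] [ChartedSpace (EuclideanSpace ℝ (Fin 4)) X]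
    [IsManifold (𝓡 4) ∞ X] (S : Fin 3 → Set X),
    (⋃ l, S l) = univ → (∀ l, IsCompact (S l)) →
    (∀ l l', l ≠ l' → Disjoint (interior (S l)) (S l')) → ∀ (m : Fin 3) (Gr Gn : X → ℝ),
    ContMDiff (𝓡 4) 𝓘(ℝ, ℝ) ∞ Gr → ContMDiff (𝓡 4) 𝓘(ℝ, ℝ) ∞ Gn →
    (∀ p ∈ S (refIdx m), p ∉ interior (S (refIdx m)) → Gr p = 1) →
    (∀ p ∈ interior (S (refIdx m)), Gr p < 1) →
    (∀ p ∈ S (refIdx m), p ∉ interior (S (refIdx m)) → p ∉ (⋂ l, S l) →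
      ¬ IsMCriticalPt (𝓡 4) Gr p) →
    (∀ p ∈ S (normIdx m), p ∉ interior (S (normIdx m)) → Gn p = 1) →
    (∀ p ∈ interior (S (normIdx m)), Gn p < 1) →
    (∀ p ∈ S (normIdx m), p ∉ interior (S (normIdx m)) → p ∉ (⋂ l, S l) →
      ¬ IsMCriticalPt (𝓡 4) Gn p) →
    (∀ p ∈ S (refIdx m), p ∉ (⋂ l, S l) →
      ∃ D : HalfSliceChart (𝓡 4) (S (refIdx m)), p ∈ D.Θ.source ∧ ∀ q ∈ D.Θ.source, q ∉ ⋂ l, S l) →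
    ∀ y ∈ S (refIdx m) ∩ S (normIdx m), y ∉ (⋂ l, S l) →
    ∃ (V V' : Set X), IsOpen V ∧ IsOpen V' ∧ y ∈ V ∧ closure V ⊆ V' ∧ ∃ η : ℝ, 0 < η ∧
      (∀ x ∈ V', ¬ IsMCriticalPt (𝓡 4) Gr x) ∧ (∀ x ∈ V', ¬ IsMCriticalPt (𝓡 4) Gn x) ∧
      (∀ x ∈ V', Gr x = 1 ↔ x ∈ S (refIdx m) ∩ S (normIdx m)) ∧
      (∀ x ∈ V', x ∈ S (refIdx m) ↔ Gr x ≤ 1) ∧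
      (∀ x ∈ V', x ∈ S (normIdx m) ↔ 1 ≤ Gr x) ∧
      (∀ ψ : ℝ → ℝ, Differentiable ℝ ψ → (∀ t, 0 ≤ ψ t ∧ ψ t ≤ 1) →
        (∀ t, |t * deriv ψ t| ≤ η) → ∀ x ∈ V', ∀ f : X → ℝ, ContMDiff (𝓡 4) 𝓘(ℝ, ℝ) ∞ f →
          (f =ᶠ[𝓝 x] fun w => Gn w + ψ (Gr w - 1) * (1 - (Gr w - 1) - Gn w)) →
          ¬ IsMCriticalPt (𝓡 4) f x)

/-- **Registered helper stub `stub_seamFormLocalToolkit`** of line `lp-by-sphere-system-surgery`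
(local seam analysis for the seam normalisation `stub_seamForm`).
[cite: AbramsGayKirby2018, proof of Thm. 5] -/
theorem stub_seamFormLocalToolkit : SeamFormLocalToolkit :=
  fun _ _ _ _ _ _ hcov hcomp hdisj m _ _ hGr hGn hr1 hr2 hr3 hn1 hn2 hn3 hhalf _ hy hyF =>
    seamLocal hcov hcomp hdisj m hGr hGn hr1 hr2 hr3 hn1 hn2 hn3 hhalf hy hyF

end Summit.SmoothPoincare4.SmoothPoincare4.Cruxes.AgkCor6Sufficiency.LpBySphereSystemSurgery

end
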